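import Summits.BirchSwinnertonDyer.Rank1Residual.GaloisImage.KuriharaRecordBSDpThreeLevelOneEnd
import Summits.BirchSwinnertonDyer.Rank1Residual.GaloisImage.KuriharaRecordBSDpThreeLevelOneEndOfBaseRigidity
import Summits.BirchSwinnertonDyer.Rank1Residual.GaloisImage.KuriharaRecordBSDpThreeLevelOneEndOfFacts
import Summits.BirchSwinnertonDyer.Rank1Residual.Additive.X4ThreeKuriharaCertRecordsS2_1
import Summits.BirchSwinnertonDyer.Rank1Residual.GaloisImage.LocalThreeTorsionDecider
import HarnessLib

/-!
# THE FIRST END-m1 PILOT RECORD SHAPE: `BSD(E,3)` for `2718d1` at the level `31·61 = 1891` from ONE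
# level-one Kurihara unit, two level-zero values and ONE port — no [S24] Thm. 4.4 (2), no `inv′` family,
# no sub-level vanishing, no parity
# (cell `b2b-bsdres`, team n1011, ROUTE-1 §33.3 / §33.8 (R1-57); row T-R1-57-B capstone; seat p18)

HONEST FRAMING (cell `b2b-bsdres`, run/shared/lean/b2b/bsd-rank1-residual/, verbatim in every
file): the goal of the cell is to DELETE the COMBINATION-SHAPED residual classes of the
Birch–Swinnerton-Dyer formula for ALL analytic-rank `≤ 1` elliptic curves over `ℚ` — "full BSD
formula for every rank `≤ 1` curve in class `C`" assembled STRICTLY from published theorems — so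
that the rank-`≤ 1` remainder becomes exactly the CONSTRUCTION-SHAPED classes, which are TYPED
(missing-input `Prop`s), NOT attempted. This is not "finishing BSD". Team n1011 (N10/N11, the
additive block `X4 ∧ p = 3`): research route; no claim beyond the stated classes; the label X4 and
the mark of RESIDUAL-MAP §I N11 are UNCHANGED by this file; nothing is booked.  This is a PER-PAIR
RECORD SHAPE (certificate-evidence), NOT a class theorem.  CONDITIONAL on: the UPPER-half named
facts of the X4 chain of record (`hKatoS hDel hmodD hKatoχ`, with `hGZK hmod h26`), ONE [S24] fact
`hS24` (Thm. 4.4 (1), interim — only through n1011-p09's level-one injectivity; replaced by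
n1011-p11's G5 when it lands), Cassels–Tate (`hCT`), the Poitou–Tate family at `3`, Tate's `hEP`,
the ONE port `KatoKuriharaPortThreeAt W 0 v₃` (FLAG `K22-Thm3.13-PORT@3`), the row's analytic rank
(`hr`, Cremona) and optimal parametrisation datum (`D`, `hopt`), and THREE KURIHARA VALUES taken as
HYPOTHESES (`hδ`), each an EVIDENCE value with its sources: (a) `δ̃_{1891}(ψ) ≢ 0 (mod 3)` —
engine 2 j128824 + ENG-D KFOLD blind AGREE (n1011-p03 `X4ThreeKuriharaCertRecordsS2_1` docstring of
`bsdp3_kur_v2718d1`; p03's `KURIHARA-RECORDS-INDEX.tsv` row 5: E2-AT3 STAGE 2 j128824 `2 mod 3`,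
ENG-D KFOLD-S0D3 9ba005ba24e0b029 (tables j129014/j130123) `2 mod 3`); (b) `δ̃_1 = [0]⁺ ≡ 0 (mod 3)`
and (c) `[0]⁺ ≢ 0 (mod 27)`, i.e. `ord₃ [0]⁺ = 2` — source 1: n1011-p08 E2-AT3 STAGE 2 j128824
`STAGE2-TABLE.md` row `2718d1` (`v = 2`); source 2: Cremona's table / ecdata as carried in p08's
`curves_stage2v2.tsv` (`rank 0`, `#E(ℚ)_tors = 1`, `∏ c_ℓ = 4`, `#Ш_an = 9` ⟹ `ord₃(L(E,1)/Ω) = 2`).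
Whether the census REGISTER marks this `(row, n)` is the census cell's word, not this file's; no
register word is used here.

## What this file does

`2718d1` (`N = 2718 = 2·3²·151`; Cremona's minimal model `[1, -1, 0, -364196925, -2675085975131]`;
ADDITIVE at `3` of Kodaira type `I₇*` — potentially MULTIPLICATIVE, `ord₃ j = −7 < 0`; `c₃ = 4`,
`∏ c_ℓ = 4`; surj(3); `#E(ℚ₃)[3] = 1`; `r_an = 0`, `#Ш_an = 9`) is the FIRST of r1's 36 END-m1
candidates (ROUTE-1 §33.8: class A1, UNIT, `ord₃ #Ш_an = 2`, cyclic level-1 unit pair `31·61` on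
file).  Its curve-side certificates are ALREADY in the tree (n1011-p03 `X4ThreeKuriharaCertRecordsS2_1`:
`surj3_v2718d1`, `tamagawaProduct_v2718d1 = 4`, the point counts `card_v2718d1_31 = 27`,
`card_v2718d1_61 = 60`); this file adds the three that END-m1 needs and feeds this seat's record
corollary `Assembly.bsdp_three_potMult_of_levelOneCertificates_of_S24` (R1-57-B part 2) BY NAME:

* `LocalTorsion3.natCard_threeTorsion_2718d1` — `#E(ℚ₃)[3] = 3^0` by n1011-p17's decider
  (`threeTorsionCheck`, `k = 4`, one Hensel ball `(13, 1, 3)` with `g` a non-square: `decide +kernel`;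
  certificate found by p17's `census/loc3t_cert2.py`, unchanged);
* `isKolyvaginProduct_one_v2718d1` — `1891 = 31·61 ∈ 𝒩₁(E, 3)`: both primes good, `≠ 3`,
  `≡ 1 (mod 3)`, `3 ∣ #Ẽ(𝔽_ℓ)` (`27`, `60`);
* `forall_card_torsion_le_v2718d1` — the cyclicity flag at `1891`: ONE root of `Ψ₃ mod ℓ` (`30 mod 31`
  — needed, `9 ∣ 27`; `45 mod 61`);
* **`bsdp3_endm1_v2718d1`** — `BSD(E, 3)` for any globally minimal elliptic `W` with this integral
  model, from the binders above; `ord₃ j < 0` by `padicValRat_j_neg_of_intModel` (`9 ∤ c₄`, `3⁷ ∣ Δ`),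
  `3 ∤ c₃` from `∏ c_ℓ = 4`, `N = 2718 ≤ 130000`.

What this record does NOT carry, compared with the Route-1 pair-END pilots (`bsdp3_route1_v22077e1`):
`hS24₂`, the `inv′` Poitou–Tate family at every `3^{k′+1}` (five binders), the `3`-adic tower (the (M)
socket needs surj(3) only), the sub-level vanishings / parity (`hn2`, `hNE`, `hε`), `hL20`.  What it
carries instead: `hCT`, `hunro`, and the two level-zero VALUES.  END-m1 applies here BECAUSE
`ord₃ #Ш_an = 2` (on the `#Ш_an = 81` pilots 22077e1 / 73206p1 it yields `X ≥ 2` only, r1 §33.3).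

References: C.-H. Kim, AJM 148 (2026) Thm. 1.9 (6), Thm. 3.13, §1.2.2 [Kim2022StructureSelmer];
R. Sakamoto, JTNB 36 (2024) Thm. 4.4 (1) [Sakamoto2024]; J. E. Cremona, *Algorithms for Modular
Elliptic Curves* (1997), Table 1 [CremonaAlgorithms1997]; J. H. Silverman, AEC (2009) III.2.3,
VII.5, X.4.14 [SilvermanAEC2009].
-/

set_option autoImplicit false

noncomputable section

open scoped Classical NumberField

open WeierstrassCurve Literature.NumberTheory.EllipticCurves Literature.NumberTheory.EllipticCurves.ModularForms
  Literature.NumberTheory.EllipticCurves.Rank1Residual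
  Literature.NumberTheory.EllipticCurves.AgasheRibetStein2006
  Literature.NumberTheory.GaloisRepresentations Literature.NumberTheory.GaloisCohomology
  NumberField IsDedekindDomain
  Summit.BirchSwinnertonDyer.BirchSwinnertonDyer.Rank1Residual.IntModel
  Summit.BirchSwinnertonDyer.Rank1Residual.GaloisImage
  Summit.BirchSwinnertonDyer.Rank1Residual.X4

/-! ### `#E(ℚ₃)[3] = 1` for `2718d1` (n1011-p17's decider) -/

namespace Summit.BirchSwinnertonDyer.Rank1Residual.GaloisImage.LocalTorsion3

/-- **`2718d1`** (`N = 2·3²·151`, Kodaira `I₇*` at `3`; globally minimal model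
`[1, -1, 0, -364196925, -2675085975131]`): `#E(ℚ₃)[3] = 1` (`t = 0`, class A1).  Certificate
(p17's `loc3t_cert2.py`): the one root of `Ψ₃` in `ℤ₃` is the ball `(13, 1, 3)` with `g` a
non-square (`w = 0`), `k = 4` levels. [cite: CremonaAlgorithms1997, Table 1 (Cremona label 2718d1)] -/
theorem natCard_threeTorsion_2718d1 (W : WeierstrassCurve ℚ) [W.IsElliptic] [W.IsGloballyMinimal]
    (hI : W.integralModelInt = ⟨1, -1, 0, -364196925, -2675085975131⟩) :
    Nat.card {Q : (W.baseChange ℚ_[3]).toAffine.Point // (3 : ℕ) • Q = 0} = 3 ^ 0 :=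
  natCard_threeTorsion_eq_three_pow_zero_of_intModel_of_check 1 (-1) 0 (-364196925)
    (-2675085975131) W hI
    (k := 4) (cert := [((13 : ℤ), 1, 3, 0)]) (by decide +kernel)

end Summit.BirchSwinnertonDyer.Rank1Residual.GaloisImage.LocalTorsion3

namespace Summit.BirchSwinnertonDyer.Rank1Residual.Additive.X4ThreeKuriharaCert

/-! ### The level `1891 = 31·61 ∈ 𝒩₁(2718d1, 3)` and its cyclicity flag -/

/-- **`1891 = 31·61 ∈ 𝒩₁(2718d1, 3)` IN THE KERNEL** for any globally minimal elliptic `W` with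
Cremona's integral model: both primes good (`ℓ ∤ Δ`), `≠ 3`, `≡ 1 (mod 3)`, `3 ∣ #Ẽ(𝔽_ℓ)`
(`27`, `60`; n1011-p03's point counts `card_v2718d1_31` / `card_v2718d1_61` reused by name).
[cite: Kim2022StructureSelmer, §1.2.2 (PDF p. 4)] -/
theorem isKolyvaginProduct_one_v2718d1 {W : WeierstrassCurve ℚ} [W.IsElliptic] [W.IsGloballyMinimal]
    (hI : integralModelInt W = ⟨1, -1, 0, -364196925, -2675085975131⟩) :
    haveI : Fact (Nat.Prime 3) := ⟨Nat.prime_three⟩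
    Kato.IsKolyvaginProduct W 3 1 1891 := by
  haveI : Fact (Nat.Prime 3) := ⟨Nat.prime_three⟩
  haveI : Fact (Nat.Prime 31) := ⟨by norm_num⟩
  haveI : Fact (Nat.Prime 61) := ⟨by norm_num⟩
  have h31 : Kato.IsKolyvaginPrime W 3 1 31 :=
    isKolyvaginPrime_of_intModel_of_card hI 3 1 31 (by norm_num) (by decide +kernel) (by decide)
      card_v2718d1_31 (by decide)
  have h61 : Kato.IsKolyvaginPrime W 3 1 61 :=
    isKolyvaginPrime_of_intModel_of_card hI 3 1 61 (by norm_num) (by decide +kernel) (by decide)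
      card_v2718d1_61 (by decide)
  exact_mod_cast isKolyvaginProduct_mul h31 h61 (by norm_num)

/-- **The cyclicity flag `hcyc` at `n = 1891` for `2718d1` IN THE KERNEL**: `#(E₀ mod ℓ)(𝔽_ℓ)[3] ≤ 3`
at `ℓ = 31, 61` from ONE root of `Ψ₃ mod ℓ` (`30 mod 31` — here `#Ẽ(𝔽₃₁) = 27`, so the point count
alone is silent; `45 mod 61`). [cite: SilvermanAEC2009, III.2.3 and Exercise 3.7]
[cite: Kim2022StructureSelmer, §1.2.2 and Thm. 1.10 (1)] -/
theorem forall_card_torsion_le_v2718d1 {W : WeierstrassCurve ℚ} [W.IsGloballyMinimal]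
    (hI : integralModelInt W = ⟨1, -1, 0, -364196925, -2675085975131⟩) :
    ∀ (ℓ : ℕ) [Fact ℓ.Prime], ℓ ∣ 1891 →
      Nat.card {P : ((WeierstrassCurve.integralModelInt W).map
          (Int.castRingHom (ZMod ℓ))).toAffine.Point // 3 • P = 0} ≤ 3 := by
  haveI : Fact (Nat.Prime 31) := ⟨by norm_num⟩
  haveI : Fact (Nat.Prime 61) := ⟨by norm_num⟩
  have c31 := card_three_torsion_le_of_intModel_of_psi3_root hI 31 30 (by decide +kernel)
  have c61 := card_three_torsion_le_of_intModel_of_psi3_root hI 61 45 (by decide +kernel)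
  intro ℓ hℓ hdvd
  exact forall_card_torsion_le_of_dvd_mul 3 31 61 c31 c61 ℓ (by norm_num at hdvd ⊢; exact hdvd)

/-! ### The record -/

/-- **END-m1 PILOT RECORD (CLOSES NOTHING, moves no mark): `BSD(E,3)` for `2718d1` at `31·61`,
CONDITIONAL on the named facts, the port and the three EVIDENCE values below** — for any globally
minimal elliptic `W` with Cremona's integral model `[1, -1, 0, -364196925, -2675085975131]`: this seat's
`Assembly.bsdp_three_potMult_of_levelOneCertificates_of_S24` (R1-57-B; over n1011-p09's END-m1
`Sel₃(E) ≠ 0`, R1-57-A) fed BY NAME with the curve-side certificates — `3 ∣ Δ`, `3 ∣ c₄` (`decide`),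
surj(3) (`surj3_v2718d1`), `ord₃ j < 0` (`padicValRat_j_neg_of_intModel`: `9 ∤ c₄`, `3⁷ ∣ Δ`),
`3 ∤ c₃` (`tamagawaProduct_v2718d1 = 4`), `#E(ℚ₃)[3] = 1` (`LocalTorsion3.natCard_threeTorsion_2718d1`),
`N = 2718 ≤ 130000`, the level `1891 ∈ 𝒩₁` with its cyclicity flag (kernel CERTIFICATES) — and,
as HYPOTHESES: the UPPER named facts (`hKatoS hDel hmodD hKatoχ`, `hGZK hmod h26`) with the `3`-adic
tower NOT needed on this (M) row, the interim NAMED FACT `hS24` ([S24] Thm. 4.4 (1), through p09's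
injectivity only — swapped for n1011-p11's G5 when it lands), `hCT`, the Poitou–Tate family at `3`,
`hEP`, ONE `hPort`, `hr`, the optimal datum `D`/`hopt`, and the three Kurihara VALUES `hδ` — EVIDENCE,
sources per value in the module docstring: `δ̃_{1891}(ψ) ≢ 0 (mod 3)` (engine 2 j128824 + ENG-D KFOLD
blind AGREE, p03 `X4ThreeKuriharaCertRecordsS2_1` docstring), `δ̃_1 ≡ 0 (mod 3)` and
`δ̃_1 ≢ 0 (mod 27)` (p08 STAGE2-TABLE `v = 2`; Cremona `#Ш_an = 9`, `∏ c_ℓ = 4`, `#E(ℚ)_tors = 1`).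
CERTIFICATE-EVIDENCE record SHAPE; nothing booked; no mark moved; no class closed.
[cite: Kim2022StructureSelmer, Thm. 1.9 (6) and Thm. 3.13] [cite: Sakamoto2024, Thm. 4.4 (1) (p. 926)]
[cite: CremonaAlgorithms1997, Table 1 (Cremona label 2718d1)] -/
theorem bsdp3_endm1_v2718d1
    (hKatoS : Kato2004.rankZero_padicValNat_sha_le_sub_localTamagawa_of_additive_potGood_of_imageContainsSL2)
    (hDel : Delbourgo1998.prop4_rankZero_pow_dvd_constantCoeff)
    (hGZK : rank_eq_analyticRank_of_analyticRank_le_one) (hmod : hasEntireLFunction_rat)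
    (hmodD : nonempty_modularParametrizationData)
    (hKatoχ : Wuthrich2014.kato_halfEigenCharIdeal_dvd_cyclotomicPrime_of_surjective)
    (h26 : cremona_abs_maninConstant_eq_one_of_level_le)
    (hS24 : Sakamoto2024.kolyvaginSystems_freeRankOne_zmod_three_pow)
    (hCT : exists_casselsTate_pairing (K := ℚ))
    {W : WeierstrassCurve ℚ} [W.IsElliptic] [W.IsGloballyMinimal]
    (hI : integralModelInt W = ⟨1, -1, 0, -364196925, -2675085975131⟩)
    (hr : W.analyticRank = 0)
    (D : ModularParametrizationData W 2718)
    (hopt : ∀ z ∈ D.L.lattice, ∃ w ∈ periodLattice D.f, z = D.c * w)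
    (inv : LocalInvariants ℚ 3) (hperf : inv.IsPerfect) (hsum : inv.SumLocalTermEqZero)
    (hunro : inv.UnramifiedOrthogonal) (hcompl : inv.SelmerComplement)
    (hEP : ∀ v : HeightOneSpectrum (𝓞 ℚ), localEulerPoincareCharacteristic (v.adicCompletion ℚ))
    (v₃ : HeightOneSpectrum (𝓞 ℚ)) (hv₃ : ((3 : ℕ) : 𝓞 ℚ) ∈ v₃.asIdeal)
    (hPort : KatoKuriharaPortThreeAt W 0 v₃)
    (hδ : ∃ (ψ : (ℓ : ℕ) → (ZMod ℓ)ˣ →* Multiplicative (ZMod (3 ^ 1)))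
        (ψ₂₇ : (ℓ : ℕ) → (ZMod ℓ)ˣ →* Multiplicative (ZMod (3 ^ 3))),
      (∀ ℓ ∈ (1891 : ℕ).primeFactors, Function.Surjective (ψ ℓ)) ∧
        kuriharaNumber D.f (3 ^ 1) 1891 ψ ≠ 0 ∧ kuriharaNumber D.f (3 ^ 1) 1 ψ = 0 ∧
        kuriharaNumber D.f (3 ^ 3) 1 ψ₂₇ ≠ 0) :
    haveI : Fact (Nat.Prime 3) := ⟨Nat.prime_three⟩
    BSDp W 3 := by
  haveI : Fact (Nat.Prime 3) := ⟨Nat.prime_three⟩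
  haveI : NeZero (1891 : ℕ) := ⟨by norm_num⟩
  obtain ⟨ψ, ψ₂₇, hψ, hcert, hzero₁, hunit₁⟩ := hδ
  have htam : ¬ 3 ∣ W.tamagawaProduct := by rw [tamagawaProduct_v2718d1 hI]; decide
  have hc3 : ¬ 3 ∣ (W.baseChange ℚ_[3]).localTamagawaNumber ℤ_[3] := fun h =>
    htam (h.trans (localTamagawaNumber_padic_dvd_tamagawaProduct W 3))
  have hsurj : W.HasSurjectiveModNGaloisRep ((3 : ℕ) : ℤ) := by simpa using surj3_v2718d1 hI
  have hjneg : padicValRat 3 W.j < 0 :=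
    padicValRat_j_neg_of_intModel hI 3 2 (by decide +kernel) (by decide +kernel)
  have ht0 : Nat.card {Q : (W.baseChange ℚ_[3]).toAffine.Point // (3 : ℕ) • Q = 0} = 1 :=
    (LocalTorsion3.natCard_threeTorsion_2718d1 W hI).trans (pow_zero 3)
  exact Assembly.bsdp_three_potMult_of_levelOneCertificates_of_S24 hKatoS hDel hGZK hmod hmodD hKatoχ
    h26 hS24 hCT W hI (by decide +kernel) (by decide +kernel) hsurj hjneg hc3 ht0 hr (by norm_num) D hopt
    inv hperf hsum hunro hcompl hEP v₃ hv₃ hPort 1891 (isKolyvaginProduct_one_v2718d1 hI)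
    (forall_card_torsion_le_v2718d1 hI) ψ hψ hcert hzero₁ ψ₂₇ hunit₁

/-- **END-m1 PILOT RECORD, [S24]-FREE (CLOSES NOTHING, moves no mark): `BSD(E,3)` for `2718d1` at
`31·61`, CONDITIONAL on the named UPPER facts, `hCT`, the Poitou–Tate family at `3`, `hEP`, the ONE
port and the three EVIDENCE values** — the twin of `bsdp3_endm1_v2718d1` with the interim NAMED FACT
`hS24` and `hunro` DELETED: the injectivity at the core vertex `∅` is n1011-p11's BASE RIGIDITY (R1-58,
p290143) through n1011-p09's `…_of_baseRigidity` END and this seat's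
`Assembly.bsdp_three_potMult_of_levelOneCertificates_of_baseRigidity`.  So on this row the LOWER half
of `BSD(E,3)` carries NO [S24] fact and NO four-class Chebotarev step; what remains assumed is the
PORT (FLAG `K22-Thm3.13-PORT@3`), the PT family + `hEP`, `hCT`, the UPPER-half named facts, `hr`, the
optimal datum, and the three Kurihara VALUES (EVIDENCE, sources per value in the module docstring).
CERTIFICATE-EVIDENCE record SHAPE; nothing booked; no class closed.
[cite: Kim2022StructureSelmer, Thm. 1.9 (6) and Thm. 3.13] [cite: Rubin2011, Thm. 2.8.4]
[cite: CremonaAlgorithms1997, Table 1 (Cremona label 2718d1)] -/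
theorem bsdp3_endm1_v2718d1_of_baseRigidity
    (hKatoS : Kato2004.rankZero_padicValNat_sha_le_sub_localTamagawa_of_additive_potGood_of_imageContainsSL2)
    (hDel : Delbourgo1998.prop4_rankZero_pow_dvd_constantCoeff)
    (hGZK : rank_eq_analyticRank_of_analyticRank_le_one) (hmod : hasEntireLFunction_rat)
    (hmodD : nonempty_modularParametrizationData)
    (hKatoχ : Wuthrich2014.kato_halfEigenCharIdeal_dvd_cyclotomicPrime_of_surjective)
    (h26 : cremona_abs_maninConstant_eq_one_of_level_le)
    (hCT : exists_casselsTate_pairing (K := ℚ))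
    {W : WeierstrassCurve ℚ} [W.IsElliptic] [W.IsGloballyMinimal]
    (hI : integralModelInt W = ⟨1, -1, 0, -364196925, -2675085975131⟩)
    (hr : W.analyticRank = 0)
    (D : ModularParametrizationData W 2718)
    (hopt : ∀ z ∈ D.L.lattice, ∃ w ∈ periodLattice D.f, z = D.c * w)
    (inv : LocalInvariants ℚ 3) (hperf : inv.IsPerfect) (hsum : inv.SumLocalTermEqZero)
    (hcompl : inv.SelmerComplement)
    (hEP : ∀ v : HeightOneSpectrum (𝓞 ℚ), localEulerPoincareCharacteristic (v.adicCompletion ℚ))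
    (v₃ : HeightOneSpectrum (𝓞 ℚ)) (hv₃ : ((3 : ℕ) : 𝓞 ℚ) ∈ v₃.asIdeal)
    (hPort : KatoKuriharaPortThreeAt W 0 v₃)
    (hδ : ∃ (ψ : (ℓ : ℕ) → (ZMod ℓ)ˣ →* Multiplicative (ZMod (3 ^ 1)))
        (ψ₂₇ : (ℓ : ℕ) → (ZMod ℓ)ˣ →* Multiplicative (ZMod (3 ^ 3))),
      (∀ ℓ ∈ (1891 : ℕ).primeFactors, Function.Surjective (ψ ℓ)) ∧
        kuriharaNumber D.f (3 ^ 1) 1891 ψ ≠ 0 ∧ kuriharaNumber D.f (3 ^ 1) 1 ψ = 0 ∧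
        kuriharaNumber D.f (3 ^ 3) 1 ψ₂₇ ≠ 0) :
    haveI : Fact (Nat.Prime 3) := ⟨Nat.prime_three⟩
    BSDp W 3 := by
  haveI : Fact (Nat.Prime 3) := ⟨Nat.prime_three⟩
  haveI : NeZero (1891 : ℕ) := ⟨by norm_num⟩
  obtain ⟨ψ, ψ₂₇, hψ, hcert, hzero₁, hunit₁⟩ := hδ
  have htam : ¬ 3 ∣ W.tamagawaProduct := by rw [tamagawaProduct_v2718d1 hI]; decide
  have hc3 : ¬ 3 ∣ (W.baseChange ℚ_[3]).localTamagawaNumber ℤ_[3] := fun h =>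
    htam (h.trans (localTamagawaNumber_padic_dvd_tamagawaProduct W 3))
  have hsurj : W.HasSurjectiveModNGaloisRep ((3 : ℕ) : ℤ) := by simpa using surj3_v2718d1 hI
  have hjneg : padicValRat 3 W.j < 0 :=
    padicValRat_j_neg_of_intModel hI 3 2 (by decide +kernel) (by decide +kernel)
  have ht0 : Nat.card {Q : (W.baseChange ℚ_[3]).toAffine.Point // (3 : ℕ) • Q = 0} = 1 :=
    (LocalTorsion3.natCard_threeTorsion_2718d1 W hI).trans (pow_zero 3)
  exact Assembly.bsdp_three_potMult_of_levelOneCertificates_of_baseRigidity hKatoS hDel hGZK hmod hmodD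
    hKatoχ h26 hCT W hI (by decide +kernel) (by decide +kernel) hsurj hjneg hc3 ht0 hr (by norm_num) D hopt
    inv hperf hsum hcompl hEP v₃ hv₃ hPort 1891 (isKolyvaginProduct_one_v2718d1 hI)
    (forall_card_torsion_le_v2718d1 hI) ψ hψ hcert hzero₁ ψ₂₇ hunit₁

/-- **END-m1 PILOT RECORD, NAMED-FACTS form (CLOSES NOTHING, moves no mark): `BSD(E,3)` for `2718d1`
at `31·61`, CONDITIONAL on NAMED FACTS {`hKatoS hDel hGZK hmod hmodD hKatoχ h26`, `hCT`, `hPT`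
(`poitouTate_selmerStructure_duality ℚ`), `hEP`}, the ONE port, `hr`, the optimal datum and the three
EVIDENCE values** — the twin of `bsdp3_endm1_v2718d1_of_baseRigidity` with the four Poitou–Tate binders
`inv hperf hsum hcompl` replaced by the one named fact `hPT` (this seat's
`Assembly.bsdp_three_potMult_of_levelOneCertificates_of_facts`).  This is the record in the cell's
"WHAT A RECORD COSTS" currency: named facts + port + row certificates + values, nothing else.  NO [S24]
fact; CERTIFICATE-EVIDENCE record SHAPE; nothing booked; no class closed.
[cite: Kim2022StructureSelmer, Thm. 1.9 (6) and Thm. 3.13] [cite: MilneADT2006, Ch. I, Thm. 4.10(b)]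
[cite: CremonaAlgorithms1997, Table 1 (Cremona label 2718d1)] -/
theorem bsdp3_endm1_v2718d1_of_facts
    (hKatoS : Kato2004.rankZero_padicValNat_sha_le_sub_localTamagawa_of_additive_potGood_of_imageContainsSL2)
    (hDel : Delbourgo1998.prop4_rankZero_pow_dvd_constantCoeff)
    (hGZK : rank_eq_analyticRank_of_analyticRank_le_one) (hmod : hasEntireLFunction_rat)
    (hmodD : nonempty_modularParametrizationData)
    (hKatoχ : Wuthrich2014.kato_halfEigenCharIdeal_dvd_cyclotomicPrime_of_surjective)
    (h26 : cremona_abs_maninConstant_eq_one_of_level_le)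
    (hCT : exists_casselsTate_pairing (K := ℚ))
    {W : WeierstrassCurve ℚ} [W.IsElliptic] [W.IsGloballyMinimal]
    (hI : integralModelInt W = ⟨1, -1, 0, -364196925, -2675085975131⟩)
    (hr : W.analyticRank = 0)
    (D : ModularParametrizationData W 2718)
    (hopt : ∀ z ∈ D.L.lattice, ∃ w ∈ periodLattice D.f, z = D.c * w)
    (hPT : poitouTate_selmerStructure_duality ℚ)
    (hEP : ∀ v : HeightOneSpectrum (𝓞 ℚ), localEulerPoincareCharacteristic (v.adicCompletion ℚ))
    (v₃ : HeightOneSpectrum (𝓞 ℚ)) (hv₃ : ((3 : ℕ) : 𝓞 ℚ) ∈ v₃.asIdeal)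
    (hPort : KatoKuriharaPortThreeAt W 0 v₃)
    (hδ : ∃ (ψ : (ℓ : ℕ) → (ZMod ℓ)ˣ →* Multiplicative (ZMod (3 ^ 1)))
        (ψ₂₇ : (ℓ : ℕ) → (ZMod ℓ)ˣ →* Multiplicative (ZMod (3 ^ 3))),
      (∀ ℓ ∈ (1891 : ℕ).primeFactors, Function.Surjective (ψ ℓ)) ∧
        kuriharaNumber D.f (3 ^ 1) 1891 ψ ≠ 0 ∧ kuriharaNumber D.f (3 ^ 1) 1 ψ = 0 ∧
        kuriharaNumber D.f (3 ^ 3) 1 ψ₂₇ ≠ 0) :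
    haveI : Fact (Nat.Prime 3) := ⟨Nat.prime_three⟩
    BSDp W 3 := by
  haveI : Fact (Nat.Prime 3) := ⟨Nat.prime_three⟩
  haveI : NeZero (1891 : ℕ) := ⟨by norm_num⟩
  obtain ⟨ψ, ψ₂₇, hψ, hcert, hzero₁, hunit₁⟩ := hδ
  have htam : ¬ 3 ∣ W.tamagawaProduct := by rw [tamagawaProduct_v2718d1 hI]; decide
  have hc3 : ¬ 3 ∣ (W.baseChange ℚ_[3]).localTamagawaNumber ℤ_[3] := fun h =>
    htam (h.trans (localTamagawaNumber_padic_dvd_tamagawaProduct W 3))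
  have hsurj : W.HasSurjectiveModNGaloisRep ((3 : ℕ) : ℤ) := by simpa using surj3_v2718d1 hI
  have hjneg : padicValRat 3 W.j < 0 :=
    padicValRat_j_neg_of_intModel hI 3 2 (by decide +kernel) (by decide +kernel)
  have ht0 : Nat.card {Q : (W.baseChange ℚ_[3]).toAffine.Point // (3 : ℕ) • Q = 0} = 1 :=
    (LocalTorsion3.natCard_threeTorsion_2718d1 W hI).trans (pow_zero 3)
  exact Assembly.bsdp_three_potMult_of_levelOneCertificates_of_facts hKatoS hDel hGZK hmod hmodD
    hKatoχ h26 hCT W hI (by decide +kernel) (by decide +kernel) hsurj hjneg hc3 ht0 hr (by norm_num) D hopt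
    hPT hEP v₃ hv₃ hPort 1891 (isKolyvaginProduct_one_v2718d1 hI)
    (forall_card_torsion_le_v2718d1 hI) ψ hψ hcert hzero₁ ψ₂₇ hunit₁

end Summit.BirchSwinnertonDyer.Rank1Residual.Additive.X4ThreeKuriharaCert

end
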